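import Mathlib.Tactic.Linarith
import Mathlib.Tactic.NormNum
import Mathlib.Tactic.Ring
import HarnessLib

/-!
# The (0,1) cell of the ι-window, XLI (companion B): the product ground `B₁ × B₂`, XXVIII — THE CORNER XIII, ADDENDUM 1
# (report [XLI] `H2-ZERO-ONE-41.md` §11): arithmetic shadow of LEMMA LUCAS / COROLLARY TRACE-GROWTH and LEMMA CROSS-BOUND

Family `hodge`, b2b cell `hweil` (helper of item stmt-HodgeConjecture-2524). Report
`run/shared/lean/b2b/hodge-weil/b2b-hweil-pv1-g53/H2-ZERO-ONE-41.md` ([XLI]) §11 (ADDENDUM 1). Context (the report's words, nothing of them formalised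
here): for a balanced thick line with `ν = 2` the t̄-coefficient of `t̄^{k}` at x̃-order `k − 1` is the Lucas polynomial `q_k`, `q_{k+1} = Φ₂q_{k−1} + Ψ₁q_k`,
`q_1 = 1`, `q_2 = Ψ₁`; at a point where `Ψ₁` has a pole of order `π` and `Φ₂` one of order `a` the pole order `p_k` of `q_k` obeys the max-plus recursion
below, whence `k″_j ≥ jπ` (if `2π > a`) or `k″_{2i} ≥ ia` (if `a > 2π`); summed over the points this is a linear growth `d″_{2i} ≥ iσ` of the t̄-layers which
the pairing cap `ℓ″_{2i} ≤ 10 + c_0 + 2(b − 1 − 2i)` turns into `σ ≤ 4 + (24 + 2c_0)/(b − 2)`. The theorems below are the integer arithmetic. They claim no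
geometry. HONEST FRAMING: census work inside the ladder's H2 test ((0,1) cell) on the SPECIAL fourfold `X₀`; nothing here is a rung; no case of the Hodge
conjecture is proved; no statement of [Markman 2025] / [Perry 2026] / [EdGFS 2025] is used.
-/

-- mandated namespace `Summit.HodgeConjecture.HodgeConjecture.…` (Problem = Summit) trips `linter.dupNamespace`; the lakefile disables it
-- tree-wide (weak option), restated here so stand-alone elaboration is warning-free too.
set_option linter.dupNamespace false

namespace Summit.HodgeConjecture.HodgeConjecture.WeilTypeLadder

section ProductGroundTwentyEightB

/-- **[XLI] 11.1 (LEMMA LUCAS, the dominant-trace branch).** If the pole orders satisfy `p 1 = 0`, `p 2 = π` and the ultrametric recursion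
`p (k+2) = max (a + p k) (π + p (k+1))` (no cancellation because the two terms differ), and `a < 2π`, then `p (k+1) = k·π` for all `k`:
the t̄-layer `k″_{k}` at that point is at least `kπ`. [induction on the pair `(p (k+1), p (k+2))`, `nlinarith`] -/
theorem pg28b_lucas_trace_branch (a π : ℕ) (hdom : a < 2 * π) (p : ℕ → ℕ) (h1 : p 1 = 0) (h2 : p 2 = π)
    (hrec : ∀ k : ℕ, 1 ≤ k → p (k + 2) = max (a + p k) (π + p (k + 1))) :
    ∀ k : ℕ, p (k + 1) = k * π ∧ p (k + 2) = (k + 1) * π := by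
  intro k
  induction k with
  | zero => exact ⟨by simpa using h1, by simpa using h2⟩
  | succ k ih =>
    obtain ⟨e1, e2⟩ := ih
    refine ⟨by simpa [Nat.add_assoc] using e2, ?_⟩
    have h := hrec (k + 1) (by omega)
    have e4 : k + 1 + 1 = k + 2 := by ring
    rw [e4] at h
    have e5 : k + 1 + 2 = k + 3 := by ring
    rw [e5, e1, e2] at h
    have hle : a + k * π ≤ π + (k + 1) * π := by nlinarith
    rw [max_eq_right hle] at h
    have e6 : k + 1 + 2 = k + 3 := by ring
    rw [e6, h]
    ring

/-- **[XLI] 11.1 (LEMMA LUCAS, the dominant-norm branch, upper/lower bookkeeping).** With the same recursion in inequality form — `p (k+2) ≤ max …` always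
(ultrametric) and `p (k+2) = a + p k` whenever `a + p k > π + p (k+1)` (strict domination, no cancellation) — and `2π < a`: the odd-indexed poles are EXACT,
`p (2i+1) = i·a`, and the even ones bounded, `p (2i+2) ≤ i·a + π`; so `k″_{2i} ≥ i·a` at that point. [induction on `i`, `omega`] -/
theorem pg28b_lucas_norm_branch (a π : ℕ) (hdom : 2 * π < a) (p : ℕ → ℕ) (h1 : p 1 = 0) (h2 : p 2 = π)
    (hle : ∀ k : ℕ, 1 ≤ k → p (k + 2) ≤ max (a + p k) (π + p (k + 1)))
    (heq : ∀ k : ℕ, 1 ≤ k → π + p (k + 1) < a + p k → p (k + 2) = a + p k) :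
    ∀ i : ℕ, p (2 * i + 1) = i * a ∧ p (2 * i + 2) ≤ i * a + π := by
  intro i
  induction i with
  | zero => exact ⟨by simpa using h1, by simpa using h2.le⟩
  | succ i ih =>
    obtain ⟨ho, he⟩ := ih
    -- odd step: p(2i+3) = a + p(2i+1) since π + p(2i+2) ≤ π + i a + π < a + i a
    have hodd : p (2 * i + 3) = (i + 1) * a := by
      have hlt : π + p (2 * i + 1 + 1) < a + p (2 * i + 1) := by
        have : 2 * i + 1 + 1 = 2 * i + 2 := by ring
        rw [this, ho]; nlinarith
      have := heq (2 * i + 1) (by omega) hlt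
      have e : 2 * i + 1 + 2 = 2 * i + 3 := by ring
      rw [e] at this; rw [this, ho]; ring
    refine ⟨by
      have e : 2 * (i + 1) + 1 = 2 * i + 3 := by ring
      rw [e]; exact hodd, ?_⟩
    -- even step: p(2i+4) ≤ max(a + p(2i+2), π + p(2i+3)) ≤ max(a + i a + π, π + (i+1) a) = (i+1) a + π
    have hb := hle (2 * i + 2) (by omega)
    have e1 : 2 * i + 2 + 2 = 2 * (i + 1) + 2 := by ring
    have e2 : 2 * i + 2 + 1 = 2 * i + 3 := by ring
    rw [e1, e2, hodd] at hb
    have hmax : max (a + p (2 * i + 2)) (π + (i + 1) * a) ≤ (i + 1) * a + π := by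
      apply max_le
      · nlinarith
      · omega
    exact le_trans hb hmax

/-- **[XLI] 11.2–11.3 (COROLLARY TRACE-GROWTH and LEMMA CROSS-BOUND, arithmetic).** (a) The linear growth `d″_{2i} ≥ i·σ` of the t̄-layers against the
pairing cap `ℓ″_{2i} = d″_{2i} − 4i ≤ 10 + c_0 + 2(b − 1 − 2i)` at the deepest even layer `2i ≥ b − 2` gives `σ(b − 2) ≤ 2(2b + 8 + c_0)`, i.e.
`(σ − 4)(b − 2) ≤ 24 + 2c_0`; for `b ≥ 22` and `c_0 ≤ 9` this is `σ ≤ 6`, and with `c_0 ≤ 29`, `σ ≤ 8`. (b) The sub-case `Ψ₁ ≡ 0`: `σ = 4 + z₂` (all poles of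
`Φ₂` visible), so `z₂(b − 2) ≤ 24 + 2c_0`: for `b ≥ 22`, `c_0 ≤ 9`: `z₂ ≤ 2`. (c) CROSS-BOUND's sum: if at each of `n` crossing points `τ_p ≤ e_p + 2β(μ_p + λ_p)`
then `τ = Στ_p ≤ Σe_p + 2β(Σμ_p + Σλ_p)`; with `Σμ_p = 7`: `τ ≤ E + 2β(7 + L)` — the two-point instance. [`nlinarith`, `omega`] -/
theorem pg28b_trace_growth_cross_bound :
    (∀ σ b c i d : ℤ, 22 ≤ b → 0 ≤ σ → b - 2 ≤ 2 * i → 2 * i ≤ b - 1 → i * σ ≤ d → d - 4 * i ≤ 10 + c + 2 * (b - 1 - 2 * i) →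
        (σ - 4) * (b - 2) ≤ 24 + 2 * c) ∧
    (∀ σ b c : ℤ, 22 ≤ b → (σ - 4) * (b - 2) ≤ 24 + 2 * c → c ≤ 9 → σ ≤ 6) ∧
    (∀ σ b c : ℤ, 22 ≤ b → (σ - 4) * (b - 2) ≤ 24 + 2 * c → c ≤ 29 → σ ≤ 8) ∧
    (∀ z b c : ℤ, 22 ≤ b → 0 ≤ z → (4 + z - 4) * (b - 2) ≤ 24 + 2 * c → c ≤ 9 → z ≤ 2) ∧
    (∀ τ₁ τ₂ e₁ e₂ β μ₁ μ₂ l₁ l₂ : ℤ, τ₁ ≤ e₁ + 2 * β * (μ₁ + l₁) → τ₂ ≤ e₂ + 2 * β * (μ₂ + l₂) →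
        τ₁ + τ₂ ≤ (e₁ + e₂) + 2 * β * ((μ₁ + μ₂) + (l₁ + l₂))) := by
  refine ⟨fun σ b c i d hb hσ hi1 hi2 h1 h2 => ?_, fun σ b c hb h hc => ?_, fun σ b c hb h hc => ?_,
    fun z b c hb hz h hc => ?_, fun τ₁ τ₂ e₁ e₂ β μ₁ μ₂ l₁ l₂ h1 h2 => by linarith⟩
  · -- i σ ≤ d ≤ 4i + 10 + c + 2b - 2 - 4i = 2b + 8 + c, and 2i ≥ b - 2
    have hd : i * σ ≤ 2 * b + 8 + c := by linarith
    nlinarith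
  · rcases lt_or_ge 4 σ with h' | h'
    · nlinarith
    · linarith
  · rcases lt_or_ge 4 σ with h' | h'
    · nlinarith
    · linarith
  · nlinarith

/-- **[XLI] 11.1 (LEMMA LUCAS, the dominant-trace branch) — HONEST RE-TYPE (referee-g171 R892, GP53-A1; appended by pv1-g54, [XLII] 1.3 (A4)).**
`pg28b_lucas_trace_branch` above assumes the max-plus EQUALITY `p (k+2) = max (a + p k) (π + p (k+1))` for every `k`; the report's argument
([XLI] 11.1 (c)) earns equality only under STRICT DOMINATION of the trace term (the ultrametric inequality gives `≤` always, and equality when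
the two valuations differ). This version assumes only that: `heq : a + p k < π + p (k+1) → p (k+2) = π + p (k+1)`. With `a < 2π`, `p 1 = 0`,
`p 2 = π` the strict domination holds at every step by induction, so the conclusion `p (k+1) = k·π` is unchanged (the inequality hypothesis is
not even needed). The theorem above remains true as stated; this is the form that matches the proof. [induction, `nlinarith`; the referee's probe
`b2b-hweil-ref-g171/repro/LucasTraceRetype.lean` re-typed without the unused `hle`] -/
theorem pg28b_lucas_trace_branch_honest (a π : ℕ) (hdom : a < 2 * π) (p : ℕ → ℕ) (h1 : p 1 = 0) (h2 : p 2 = π)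
    (heq : ∀ k : ℕ, 1 ≤ k → a + p k < π + p (k + 1) → p (k + 2) = π + p (k + 1)) :
    ∀ k : ℕ, p (k + 1) = k * π ∧ p (k + 2) = (k + 1) * π := by
  intro k
  induction k with
  | zero => exact ⟨by simpa using h1, by simpa using h2⟩
  | succ k ih =>
    obtain ⟨e1, e2⟩ := ih
    refine ⟨by simpa [Nat.add_assoc] using e2, ?_⟩
    have hlt : a + p (k + 1) < π + p (k + 1 + 1) := by
      have e : k + 1 + 1 = k + 2 := by ring
      rw [e, e1, e2]; nlinarith
    have h := heq (k + 1) (by omega) hlt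
    have e5 : k + 1 + 2 = k + 3 := by ring
    have e4 : k + 1 + 1 = k + 2 := by ring
    rw [e5, e4, e2] at h
    have e6 : k + 1 + 2 = k + 3 := by ring
    rw [e6, h]; ring

/-- **[XLI] 11.2 (ii) (COROLLARY TRACE-GROWTH) — ERRATUM (referee-g171 R892; appended by pv1-g54, [XLII] 1.3 (A3)).** In TRACE-GROWTH's bound
`(σ − 4)(b − 2) ≤ 24 + 2c₀` the value `σ = 8` (the no-tie case `π₁ = 2`, `z₂ = 0` of 11.2 (ii)) needs `c₀ ≥ 2b − 16` (= 28 at `b = 22`), not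
«`c₀ ≥ 9`» as [XLI] 11.2 (ii) printed; consequently with `c₀ ≤ 28` and `b ≥ 23` one has `σ ≤ 7 < 8`, i.e. the no-tie case forces `Ψ₁ ≡ 0` for
every `b ≥ 23` (stronger than stated). [`nlinarith`, `omega`] -/
theorem pg28b_trace_growth_erratum :
    (∀ b c : ℤ, (8 - 4) * (b - 2) ≤ 24 + 2 * c → 2 * b - 16 ≤ c) ∧
    (∀ b c σ : ℤ, 23 ≤ b → c ≤ 28 → 0 ≤ σ → (σ - 4) * (b - 2) ≤ 24 + 2 * c → σ ≤ 7) := by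
  refine ⟨fun b c h => by linarith, fun b c σ hb hc hσ h => ?_⟩
  rcases lt_or_ge 7 σ with h' | h'
  · nlinarith
  · linarith

end ProductGroundTwentyEightB

end Summit.HodgeConjecture.HodgeConjecture.WeilTypeLadder
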